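import Summits.ResolutionOfSingularities.ResolutionOfSingularities.Theorems.EquisingularLiftEquisingularLiftNatSpecimenLinearConeCharts
import HarnessLib

/-!
# [OURS · L1 W4.5(b)] EL♮ FOR CONES WITH A LINEAR VERTEX `ℙʳ` OVER SMOOTH HYPERSURFACES, EVERY DIMENSION: ONE blow-up along the vertex
# (crux `Theses.EquisingularLift.EquisingularLiftNat`, stmt-ResolutionOfSingularities-20038)

NOT a statement of any manuscript; OURS kernel theorem (cell `res-hironaka`, chain w45b; seat res-D-pv-013, own initiative, counted 0). AI-written,
weaker than expert review. No definition, no `sorry`, standard axioms.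

The first any-`n` instance family of EL♮ with a POSITIVE-DIMENSIONAL centre. Setting of …LinearConeCharts: `G ∈ K[T₀,…,T_{m+1}]` prime and
homogeneous with regular idle-variable charts (e.g. every nonsingular form, `m ≥ 1`); injective `ι : Fin (m+2) → Fin (n+2)` (variables of the cone
form `F = rename ι G`) and `e : Fin (r+1) → Fin (n+2)` (cone directions), complementary. Then the cone `H = V₊(F) ⊂ ℙⁿ⁺¹_K` with vertex
`L = V(x_a : a ∉ range e) ≅ ℙʳ` satisfies `ELNatAt p K (n+1) H ι_H`: `O = 𝕎(K)`, ONE horizontal E1 step = the blow-up of `ℙⁿ⁺¹_O` along the `O`-smooth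
`ℙʳ_O = V(x_a : a ∉ range e)` — the horizontal lift of the singular locus `L` — (`elNatAt_of_linearCentreKill`, p535275); downstairs every blow-up
of `H` along `Λ·𝒪_H` is regular (`HypersurfaceSpecimen.isRegular_of_isBlowup_comap_of_charts` with the charts of …LinearConeCharts).

* `LinCone.isIntegral_hypersurface`, `rename_mem_span`, `exists_X_not_mem_span`, `support_subset_range`, `not_range_subset_support`;
* **`LinCone.isRegular_of_isBlowup_comap`**, **`LinCone.elNatAt_linCone`** (any complementary `ι, e`), **`LinCone.elNatAt_linCone_of_isNonsingularForm`**
  (`m ≥ 1`); the standard instances in `ℙ^{r+m+2}` (`ι = Fin.natAdd (r+1)`, `e = Fin.castAdd (m+2)`): `LinCone.elNatAt_linCone_natAdd`,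
  `LinCone.elNatAt_fermatLinCone` (`x_{r+1}ᵈ + ⋯ + x_{r+m+2}ᵈ = 0`, e.g. the quadric threefold `x₂² + x₃² + x₄² = 0 ⊂ ℙ⁴` singular along a line);
* `LinCone.not_isRegular_hypersurface` (`d ≥ 2`: not regular — genuine one-step instances).

References: Hartshorne II Prop. 5.9, I Thm. 5.1; The Stacks Project 0804, 0805 — through the cited tree files.
-/

set_option linter.dupNamespace false -- mandated namespace `Summit.<Summit>.<Problem>` of this single-conjunct summit

noncomputable section

open CategoryTheory CategoryTheory.Limits AlgebraicGeometry TopologicalSpace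
open MvPolynomial HomogeneousLocalization
open Literature.AlgebraicGeometry.Resolution
open Literature.AlgebraicGeometry.Motives Literature.AlgebraicGeometry.Motives.SmoothHypersurface
open Literature.AlgebraicGeometry.Motives.ProjectiveSpace
open AlgebraicGeometry.Scheme.IdealSheafData
open Summit.ResolutionOfSingularities.ResolutionOfSingularities.Cruxes.EquisingularLift.StrataSplit

namespace Summit.ResolutionOfSingularities.ResolutionOfSingularities.Cruxes.EquisingularLiftNat.Sections

namespace LinCone

variable (k : Type) [Field k] {n r m : ℕ} (ι : Fin (m + 2) → Fin (n + 2)) (hι : Function.Injective ι)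
  (e : Fin (r + 1) → Fin (n + 2)) (hιe : ∀ l, ι l ∉ Set.range e) (heι : ∀ a, a ∉ Set.range e → a ∈ Set.range ι)
  (G : MvPolynomial (Fin (m + 2)) k) {d : ℕ} (hG : G.IsHomogeneous d)
  (hF : (rename ι G).IsHomogeneous d) (hd : 0 < d) (hGp : Prime G)
  (hreg : ∀ i : Fin (m + 2), IsRegularRing (MvPolynomial (Fin (m + 2)) k ⧸
    Ideal.span {aeval (Function.update (X : Fin (m + 2) → MvPolynomial (Fin (m + 2)) k) i 1) G}))

attribute [local instance] MvPolynomial.gradedAlgebra ProjBaseChange.algebraBase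

/-! ## The cone form: prime, integral hypersurface, in the ideal of the vertex -/

include hι hG hGp in
/-- The cone `V₊(rename ι G)` is an integral scheme (`rename ι G` is prime: `IdleVar.prime_rename`). [folklore] -/
theorem isIntegral_hypersurface : AlgebraicGeometry.IsIntegral (hypersurface (rename ι G)).left :=
  HypersurfaceSpecimen.isIntegral_hypersurface_of_prime k _ hG.rename_isHomogeneous (IdleVar.prime_rename ι hι hGp)

include hG hd in
/-- **`F ∈ (x_{ι 0}, …, x_{ι (m+1)})`** for `G` homogeneous of positive degree: the vertex `L` lies on the cone. [folklore] -/
theorem rename_mem_span :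
    rename ι G ∈ Ideal.span (Set.range fun j : Fin (m + 2) => (X (ι j) : MvPolynomial (Fin (n + 2)) k)) := by
  classical
  have hG0 : G.coeff 0 = 0 := hG.coeff_eq_zero (by
    rw [map_zero]
    omega)
  have hmem : G ∈ Ideal.span (Set.range (X : Fin (m + 2) → MvPolynomial (Fin (m + 2)) k)) := by
    rw [← Set.image_univ, MvPolynomial.mem_ideal_span_X_image]
    intro s hs
    have hs0 : s ≠ 0 := by
      rintro rfl
      exact (mem_support_iff.mp hs) hG0
    obtain ⟨j, hj⟩ := Finsupp.ne_iff.mp hs0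
    exact ⟨j, Set.mem_univ _, hj⟩
  have h := Ideal.mem_map_of_mem (rename ι : MvPolynomial (Fin (m + 2)) k →ₐ[k] MvPolynomial (Fin (n + 2)) k) hmem
  rw [Ideal.map_span, ← Set.range_comp] at h
  have hfun : (⇑(rename ι : MvPolynomial (Fin (m + 2)) k →ₐ[k] MvPolynomial (Fin (n + 2)) k) ∘ (X : Fin (m + 2) → MvPolynomial (Fin (m + 2)) k)) =
      fun j : Fin (m + 2) => (X (ι j) : MvPolynomial (Fin (n + 2)) k) := by
    funext j
    simp [rename_X]
  rwa [hfun] at h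

include hι hGp in
/-- **Some `x_{ι a}` is not a multiple of `F`** (`G` prime): else two distinct variables would both be associated to `F`. [folklore] -/
theorem exists_X_not_mem_span : ∃ a : Fin (m + 2), (X (ι a) : MvPolynomial (Fin (n + 2)) k) ∉ Ideal.span {rename ι G} := by
  by_contra h
  push Not at h
  have hFp := IdleVar.prime_rename ι hι hGp
  have h1 : rename ι G ∣ (X (ι 0) : MvPolynomial (Fin (n + 2)) k) := Ideal.mem_span_singleton.mp (h 0)
  have h2 : rename ι G ∣ (X (ι 1) : MvPolynomial (Fin (n + 2)) k) := Ideal.mem_span_singleton.mp (h 1)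
  have a1 := hFp.irreducible.associated_of_dvd (X_prime (i := ι 0) (R := k)).irreducible h1
  have a2 := hFp.irreducible.associated_of_dvd (X_prime (i := ι 1) (R := k)).irreducible h2
  have hdvd := (a1.symm.trans a2).dvd
  rw [X_dvd_X] at hdvd
  exact absurd (hι hdvd) (by simp)

/-! ## The vertex `Λ = V₊(x_a : a ∉ range e)` and the cone -/

section Kill

variable (fk : homogeneousSubmodule (Fin (n + 2)) k →+*ᵍ homogeneousSubmodule (Fin (r + 1)) k)
  (hfk' : HomogeneousIdeal.irrelevant (homogeneousSubmodule (Fin (r + 1)) k) ≤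
    (HomogeneousIdeal.irrelevant (homogeneousSubmodule (Fin (n + 2)) k)).map fk)
  (hfkC : ∀ a : k, fk (C a) = C a) (hfke : ∀ j : Fin (r + 1), fk (X (e j)) = X j)
  (hfk0 : ∀ i : Fin (n + 2), i ∉ Set.range e → fk (X i) = 0)

include hιe hfkC hfke hfk0 hG hd in
/-- **`V(Λ) ⊆ V₊(F) = ι_H(H)`**: the E1 clause at level `0`. [folklore] -/
theorem support_subset_range :
    ((Proj.map fk hfk').ker.support : Set (Proj (homogeneousSubmodule (Fin (n + 2)) k))) ⊆ Set.range (hypersurfaceι (rename ι G)).left := by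
  intro x hx
  have hX : ∀ j : Fin (m + 2), (X (ι j) : MvPolynomial (Fin (n + 2)) k) ∈ x.asHomogeneousIdeal := fun j =>
    LinearCentre.X_mem_asHomogeneousIdeal_of_mem_support e fk hfk' hfkC hfke hfk0 hx (hιe j)
  refine (Set.ext_iff.mp (range_hypersurfaceι (rename ι G)) x).mpr
    ((ProjectiveSpectrum.mem_zeroLocus _ _ _).mpr (Set.singleton_subset_iff.mpr ?_))
  change rename ι G ∈ x.asHomogeneousIdeal
  exact (Ideal.span_le.mpr (Set.range_subset_iff.mpr hX)) (rename_mem_span k ι G hG hd)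

include hι hιe hfkC hfke hfk0 hF hGp in
/-- **`ι_H(H) ⊄ V(Λ)`**: the generic point `(F)` of `H` misses some `V₊(x_{ι a})`. [folklore] -/
theorem not_range_subset_support :
    ¬ (Set.range (hypersurfaceι (rename ι G)).left ⊆ ((Proj.map fk hfk').ker.support : Set (Proj (homogeneousSubmodule (Fin (n + 2)) k)))) := by
  intro h
  have hmem : (pointOfPrime (rename ι G) hF (IdleVar.prime_rename ι hι hGp) : Proj (homogeneousSubmodule (Fin (n + 2)) k)) ∈
      Set.range (hypersurfaceι (rename ι G)).left := by
    refine (Set.ext_iff.mp (range_hypersurfaceι (rename ι G)) _).mpr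
      ((ProjectiveSpectrum.mem_zeroLocus _ _ _).mpr (Set.singleton_subset_iff.mpr ?_))
    exact Ideal.subset_span rfl
  obtain ⟨a, ha⟩ := exists_X_not_mem_span k ι hι G hGp
  exact ha (LinearCentre.X_mem_asHomogeneousIdeal_of_mem_support e fk hfk' hfkC hfke hfk0 (h hmem) (hιe a))

/-! ## Every blow-up of `H` along `Λ·𝒪_H` is regular -/

include hι hιe heι hfkC hfke hfk0 hG hF hd hGp hreg in
/-- **`Bl_L H` IS REGULAR, for every blow-up**: every blow-up `ρ : Z → H` of the cone along the trace `Λ·𝒪_H` of the vertex `Λ ≅ ℙʳ` is a regular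
scheme — `HypersurfaceSpecimen.isRegular_of_isBlowup_comap_of_charts` with `LinCone.isRegularRing_chartRing_off` (off `L`) and
`LinCone.isRegularRing_blowupAlgebra_vertex` (on `L`). [cite: StacksProject, Tag 0804] -/
theorem isRegular_of_isBlowup_comap (he : Function.Injective e) (Z : Scheme.{0}) (ρ : Z ⟶ (hypersurface (rename ι G)).left)
    (hρ : IsBlowup ρ (((Proj.map fk hfk').ker.comap (hypersurfaceι (rename ι G)).left))) : Scheme.IsRegular Z := by
  refine HypersurfaceSpecimen.isRegular_of_isBlowup_comap_of_charts k (rename ι G) hF hd e he fk hfk' hfkC hfke hfk0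
    (fun c hc => ?_) (fun c hc a => ?_) Z ρ hρ
  · obtain ⟨c', rfl⟩ := heι c hc
    exact isRegularRing_chartRing_off k ι hι e hιe G hF hreg c'
  · obtain ⟨i, rfl⟩ := hc
    exact isRegularRing_blowupAlgebra_vertex k ι hι e hιe heι G hG hF hGp hreg i a

end Kill

/-! ## EL♮ for cones with a linear vertex, every dimension -/

/-- **EL♮ HOLDS FOR THE CONE WITH VERTEX `ℙʳ` OVER EVERY SMOOTH HYPERSURFACE, IN EVERY DIMENSION**: for `G ∈ K[T₀,…,T_{m+1}]` prime and homogeneous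
whose idle-variable charts `K[T]/(G|_{Tᵢ := 1})` are regular rings and complementary injective `ι : Fin (m+2) → Fin (n+2)`, `e : Fin (r+1) → Fin (n+2)`,
the cone `H = V₊(G(x_{ι 0},…,x_{ι (m+1)})) ⊂ ℙⁿ⁺¹_K` with vertex `L = V(x_a : a ∉ range e) ≅ ℙʳ` (`K` algebraically closed of characteristic `p`)
satisfies `Theorems.EquisingularLift.ELNatAt p K (n+1) H ι_H` (p503491). Witnesses: `O = 𝕎(K)`, ONE blow-up of `ℙⁿ⁺¹_O` along the `O`-smooth
`ℙʳ_O = V(x_a : a ∉ range e)` — the horizontal lift of the singular locus (`elNatAt_of_linearCentreKill`); downstairs `isRegular_of_isBlowup_comap`.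
The point-vertex case `r = 0` is `ConeN.elNatAt_cone` (p537155). [OURS · L1 W4.5b] [folklore] -/
theorem elNatAt_linCone (p : ℕ) (hp : p.Prime) (K : Type) [Field K] [CharP K p] [IsAlgClosed K] {n r m : ℕ}
    (ι : Fin (m + 2) → Fin (n + 2)) (hι : Function.Injective ι) (e : Fin (r + 1) → Fin (n + 2)) (he : Function.Injective e)
    (hιe : ∀ l, ι l ∉ Set.range e) (heι : ∀ a, a ∉ Set.range e → a ∈ Set.range ι)
    (G : MvPolynomial (Fin (m + 2)) K) {d : ℕ} (hG : G.IsHomogeneous d) (hGp : Prime G)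
    (hreg : ∀ i : Fin (m + 2), IsRegularRing (MvPolynomial (Fin (m + 2)) K ⧸
      Ideal.span {aeval (Function.update (X : Fin (m + 2) → MvPolynomial (Fin (m + 2)) K) i 1) G})) :
    Theorems.EquisingularLift.ELNatAt p K (n + 1) (hypersurface (rename ι G)).left (hypersurfaceι (rename ι G)).left := by
  classical
  have hF : (rename ι G).IsHomogeneous d := hG.rename_isHomogeneous
  have hd : 0 < d := ConeN.pos_of_prime_of_isHomogeneous K G hG hGp
  obtain ⟨fk, hfk', hfkC, hfke, hfk0⟩ := LinearCentre.exists_kill (R := K) e he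
  haveI := isIntegral_hypersurface K ι hι G hG hGp
  exact elNatAt_of_linearCentreKill p hp K e he _ (hypersurfaceι (rename ι G)).left fk hfk' hfkC hfke hfk0
    (support_subset_range K ι e hιe G hG hd fk hfk' hfkC hfke hfk0)
    (not_range_subset_support K ι hι e hιe G hF hGp fk hfk' hfkC hfke hfk0)
    (fun Z ρ hρ => isRegular_of_isBlowup_comap K ι hι e hιe heι G hG hF hd hGp hreg fk hfk' hfkC hfke hfk0 he Z ρ hρ)

/-- **EL♮ FOR THE CONE WITH VERTEX `ℙʳ` OVER EVERY NONSINGULAR FORM** (`m ≥ 1`): `IsNonsingularForm.prime` and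
`Cone.isRegularRing_quotient_aeval_update_one_of_isNonsingularForm` (p526332) discharge the hypotheses of `elNatAt_linCone`. For `d ≥ 2` the singular
locus of these cones is exactly `L ≅ ℙʳ`. [OURS · L1 W4.5b] [folklore] -/
theorem elNatAt_linCone_of_isNonsingularForm (p : ℕ) (hp : p.Prime) (K : Type) [Field K] [CharP K p] [IsAlgClosed K] {n r m : ℕ}
    (hm : 1 ≤ m) (ι : Fin (m + 2) → Fin (n + 2)) (hι : Function.Injective ι) (e : Fin (r + 1) → Fin (n + 2)) (he : Function.Injective e)
    (hιe : ∀ l, ι l ∉ Set.range e) (heι : ∀ a, a ∉ Set.range e → a ∈ Set.range ι)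
    (G : MvPolynomial (Fin (m + 2)) K) {d : ℕ} (hG : G.IsHomogeneous d) (hd : 1 ≤ d) (hns : IsNonsingularForm K G) :
    Theorems.EquisingularLift.ELNatAt p K (n + 1) (hypersurface (rename ι G)).left (hypersurfaceι (rename ι G)).left :=
  elNatAt_linCone p hp K ι hι e he hιe heι G hG (hns.prime hm hd hG) (Cone.isRegularRing_quotient_aeval_update_one_of_isNonsingularForm K G hG hns)

/-- **The standard instance in `ℙ^{r+m+2}`**: cone variables `x_{r+1},…,x_{r+m+2}` (`ι = Fin.natAdd (r+1)`), vertex the coordinate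
`ℙʳ = V(x_{r+1},…,x_{r+m+2})` (`e = Fin.castAdd (m+2)`); any `r`, any nonsingular `G` with `m ≥ 1`. [OURS · L1 W4.5b] [folklore] -/
theorem elNatAt_linCone_natAdd (p : ℕ) (hp : p.Prime) (K : Type) [Field K] [CharP K p] [IsAlgClosed K] {r m : ℕ} (hm : 1 ≤ m)
    (G : MvPolynomial (Fin (m + 2)) K) {d : ℕ} (hG : G.IsHomogeneous d) (hd : 1 ≤ d) (hns : IsNonsingularForm K G) :
    Theorems.EquisingularLift.ELNatAt p K (r + 1 + m + 1)
      (hypersurface (rename (Fin.natAdd (r + 1) : Fin (m + 2) → Fin (r + 1 + m + 2)) G)).left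
      (hypersurfaceι (rename (Fin.natAdd (r + 1) : Fin (m + 2) → Fin (r + 1 + m + 2)) G)).left :=
  elNatAt_linCone_of_isNonsingularForm p hp K hm (n := r + 1 + m) (Fin.natAdd (r + 1) : Fin (m + 2) → Fin (r + 1 + m + 2))
    (Fin.natAdd_injective _ _) (Fin.castAdd (m + 2) : Fin (r + 1) → Fin (r + 1 + m + 2)) (Fin.castAdd_injective _ _)
    (fun l => natAdd_not_mem_range_castAdd (r := r) l) (fun _ ha => exists_eq_natAdd_of_not_mem_range ha) G hG hd hns

/-- **Instance: the Fermat cones with vertex `ℙʳ`**, `V₊(x_{r+1}ᵈ + ⋯ + x_{r+m+2}ᵈ) ⊂ ℙ^{r+m+2}_K`, `p ∤ d`, `m ≥ 1`, any `r` (e.g. `r = m = 1`,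
`d = 2`: the quadric threefold `x₂² + x₃² + x₄² = 0` in `ℙ⁴`, singular along the line `x₂ = x₃ = x₄ = 0`). [OURS · L1 W4.5b] [folklore] -/
theorem elNatAt_fermatLinCone (d p : ℕ) (hp : p.Prime) (K : Type) [Field K] [CharP K p] [IsAlgClosed K] {r m : ℕ} (hm : 1 ≤ m)
    (hdK : (d : K) ≠ 0) :
    Theorems.EquisingularLift.ELNatAt p K (r + 1 + m + 1)
      (hypersurface (rename (Fin.natAdd (r + 1) : Fin (m + 2) → Fin (r + 1 + m + 2))
        (∑ i : Fin (m + 2), (X i : MvPolynomial (Fin (m + 2)) K) ^ d))).left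
      (hypersurfaceι (rename (Fin.natAdd (r + 1) : Fin (m + 2) → Fin (r + 1 + m + 2))
        (∑ i : Fin (m + 2), (X i : MvPolynomial (Fin (m + 2)) K) ^ d))).left := by
  have hd : 1 ≤ d := Nat.one_le_iff_ne_zero.mpr (by rintro rfl; exact hdK (by simp))
  have hG : (∑ i : Fin (m + 2), (X i : MvPolynomial (Fin (m + 2)) K) ^ d).IsHomogeneous d :=
    IsHomogeneous.sum _ _ _ fun i _ => by simpa using (isHomogeneous_X K i).pow d
  exact elNatAt_linCone_natAdd p hp K hm _ hG hd (isNonsingularForm_sum_X_pow (n := m) hdK)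

/-! ## The cones are singular: genuine one-step instances -/

/-- **THE CONES WITH A LINEAR VERTEX ARE NOT REGULAR** (`d ≥ 2`): the vertex chart `x_{e 0} = 1` has coordinate ring `K[y]/(rename τ G)`
(`LinCone.dehomogenize_vertex`, `HypersurfaceSpecimen.exists_chartQuotEquiv`), not regular at the origin since `rename τ G` is a form of degree `≥ 2`
vanishing there with all its partials (tree `Resolution.not_isRegularLocalRing_localization_of_pderiv_eval_eq_zero`). [cite: Hartshorne1977, I Thm. 5.1] -/
theorem not_isRegular_hypersurface (K : Type) [Field K] {n r m : ℕ} (ι : Fin (m + 2) → Fin (n + 2)) (hι : Function.Injective ι)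
    (e : Fin (r + 1) → Fin (n + 2)) (hιe : ∀ l, ι l ∉ Set.range e) (G : MvPolynomial (Fin (m + 2)) K) {d : ℕ} (hG : G.IsHomogeneous d)
    (hd : 2 ≤ d) (hGp : Prime G) : ¬ Scheme.IsRegular (hypersurface (rename ι G)).left := by
  intro hreg
  have hF : (rename ι G).IsHomogeneous d := hG.rename_isHomogeneous
  have hd0 : 0 < d := by omega
  obtain ⟨τ, hτinj, hτ⟩ := exists_tau_vertex ι hι e hιe (0 : Fin (r + 1))
  have hfp : Prime (rename τ G) := IdleVar.prime_rename τ hτinj hGp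
  have hf : (rename τ G).IsHomogeneous d := hG.rename_isHomogeneous
  have hrad : (Ideal.span {rename τ G}).radical = Ideal.span {rename τ G} := ((Ideal.span_singleton_prime hfp.ne_zero).mpr hfp).radical
  obtain ⟨θ, -⟩ := HypersurfaceSpecimen.exists_chartQuotEquiv (rename ι G) hF (e 0) (rename τ G) (dehomogenize_vertex K ι e G 0 τ hτ) hrad
  -- the vertex chart is an open subscheme of `H`, hence regular, hence its (Noetherian) coordinate ring is a regular ring
  have h1 : Scheme.IsRegular (Spec (CommRingCat.of (ChartRing (rename ι G) (e 0) hF))) :=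
    @Scheme.IsRegular.of_isOpenImmersion _ _ (chart (rename ι G) (e 0) hF hd0).left (isOpenImmersion_chart_left (rename ι G) (e 0) hF hd0) hreg
  have hN : IsNoetherianRing (ChartRing (rename ι G) (e 0) hF) :=
    isNoetherianRing_of_ringEquiv (MvPolynomial (Fin (n + 1)) K ⧸ Ideal.span {rename τ G}) θ.symm
  have h2 : IsRegularRing (ChartRing (rename ι G) (e 0) hF) :=
    (@Scheme.isRegular_Spec_iff (CommRingCat.of (ChartRing (rename ι G) (e 0) hF)) hN).mp h1
  haveI : IsRegularRing (MvPolynomial (Fin (n + 1)) K ⧸ Ideal.span {rename τ G}) := IsRegularRing.of_ringEquiv θ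
  -- the origin of `K[y]/(rename τ G)` is a non-regular point
  have h0 : eval (0 : Fin (n + 1) → K) (rename τ G) = 0 := Cone.eval_zero_of_isHomogeneous K _ hf (by omega)
  have hle : Ideal.span {rename τ G} ≤ RingHom.ker (eval (0 : Fin (n + 1) → K)) :=
    (Ideal.span_singleton_le_iff_mem _).mpr ((RingHom.mem_ker).mpr h0)
  haveI h𝔫 : (RingHom.ker (eval (0 : Fin (n + 1) → K)) : Ideal (MvPolynomial (Fin (n + 1)) K)).IsMaximal :=
    RingHom.ker_isMaximal_of_surjective (eval (0 : Fin (n + 1) → K)) fun x => ⟨C x, eval_C x⟩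
  set P : Ideal (MvPolynomial (Fin (n + 1)) K ⧸ Ideal.span {rename τ G}) :=
    (RingHom.ker (eval (0 : Fin (n + 1) → K))).map (Ideal.Quotient.mk (Ideal.span {rename τ G})) with hP
  have hPcomap : P.comap (Ideal.Quotient.mk (Ideal.span {rename τ G})) = RingHom.ker (eval (0 : Fin (n + 1) → K)) := by
    rw [hP, Ideal.comap_map_of_surjective _ Ideal.Quotient.mk_surjective, ← RingHom.ker_eq_comap_bot, Ideal.mk_ker,
      sup_eq_left.mpr hle]
  haveI hPmax : P.IsMaximal := by
    refine (Ideal.map_eq_top_or_isMaximal_of_surjective _ Ideal.Quotient.mk_surjective h𝔫).resolve_left fun htop => ?_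
    have h := hPcomap
    rw [hP, htop, Ideal.comap_top] at h
    exact h𝔫.ne_top h.symm
  exact not_isRegularLocalRing_localization_of_pderiv_eval_eq_zero (0 : Fin (n + 1) → K) hfp.ne_zero h0
    (Cone.eval_zero_pderiv_of_isHomogeneous K _ hf hd) P hPcomap (IsRegularRing.isRegularLocalRing_localization P)

end LinCone

end Summit.ResolutionOfSingularities.ResolutionOfSingularities.Cruxes.EquisingularLiftNat.Sections

end
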